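import Literature.IUT.HodgeArakelov.ThetaEnvDataRecordProp31AtModelTate
import Literature.IUT.LogThetaLattice.ThetaMonoidsThm22Cor23Proofs
import HarnessLib

/-!
# [IUTchIII] Thm 2.2 (ii) (d_v) AT THE GENUINE `θ_env` RECORD OF THE TATE MODEL — for EVERY inversion label
# (proof-only corollary of the packaged [IUTchII] Prop. 3.1 structure at the model of record; K-L6)

S. Mochizuki, *Inter-universal Teichmüller theory III*, kurims manuscript, §2 Thm. 2.2 (ii) p. 65 («splitting up to
torsion … the subgroup of units and the submonoid generated by `∞θ^ι_env` meet in the torsion», diagram (d_v))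
[cite: Mochizuki2012, Thm 2.2 (ii) p.65]; *Inter-universal Teichmüller theory II*, kurims, §3 Prop. 3.1 (i) p. 87.
Claim key `Mochizuki2012` (D-0012, DISPUTED): nothing of the series is asserted; composition of LANDED theorems over the
cell's OWN model objects; no side taken on [IUTchIII] Cor. 3.12. PROOF-ONLY companion (abc-iut cell, layer L6, seat
abc-iut-w5-d031 gen 11; cone node **IUTchIII:Thm2.2(ii)** — discharged generically by abc-iut-L6-t3/t5
(`thm22_ii_splitting_of_prop31`, p412150; K4 re-closed via `prop31Statements_of_val`, p460628); THIS FILE = its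
instance AT THE K-L6 MODEL OF RECORD). NO definition, NO `Prop` fact, NO instance; nothing landed is edited.

WHAT. `thm22_ii_splitting_thetaEnvRecordOuterKummer_modelTate`: at the genuine `θ_env` record of `modelTate p` with the
print-faithful OUTER inversion family through the pointed inversion pair (abc-iut-w4-d019's `thetaEnvRecordOuterKummer`,
`e₀ := pairRhoLim …`; data of record VERBATIM as in abc-iut-w5-d072's p461404 and `ThetaEnvDataRecordProp31AtModelTate.lean`
p493591), for EVERY label `ι ∈ Π^tp_{X̲̲}` the image of `M^×_TM` and the image of `⟨∞θ^ι_env⟩` in the `×μ`-quotient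
`H / H^μ` meet in `{1}` — abc-iut-L6-t3/t5's generic closer `LogThetaLattice.thm22_ii_splitting_of_prop31` fed with
`hP :=` the packaged `Prop31Statements` of p493591 and `hμ` (`H^μ ⊆ M^×_TM`) from abc-iut-w4-d004/w5-d192's
`htors_toRecord_family` (`μ ⊆ O`). RESIDUAL (every binder after the `let`s, BY NAME) = p493591's exactly: {(H1)
`PiYddCharacteristic C` (F-2633 at the instance), the tower `τ` (DATA), `hOst` (`Π^tp_{X̲̲}`-stability of `O`), the
[IUTchII] Cor. 3.5 (K)/(E) DATA: `c`/`c₀` bijective with `μ ⊆ O`, ONE evaluation section `s₀` with `hact` and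
finite-index image, `θ ∈ θ^{1}_env` with `R₀ θ = κ₀ q`, `q` a non-unit}. No FACT-LIST row consumed.

HONEST LABEL. `modelTate` is a SEMI-SYNTHETIC model of the typed [EtTh] §1 interface: binder-discharge /
joint-satisfiability evidence for OUR typed rows only; an instance at OUR model is not the print universal closure;
nothing of [IUTchII]/[IUTchIII]/[EtTh] is asserted; no side taken on [IUTchIII] Cor. 3.12; typed ≠ proved;
instantiated ≠ endorsed; nothing here bears on whether abc is proved or refuted. [claim: Mochizuki2012, status: disputed]
-/

noncomputable section

open Literature.AnabelianGeometry.EtaleTheta (ContH1 ThetaSetting)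
open Literature.AnabelianGeometry.EtaleTheta
open _root_.Topology

namespace Literature.IUT.LogThetaLattice

open Literature.IUT.HodgeArakelov Literature.IUT.HodgeArakelov.EtaleLevels
open CohomologySystemOfContH1 EtaleThetaDataOfSetting TemperedThetaMonoids BadPrimeGaussianMonoids
open Literature.AnabelianGeometry.EtaleTheta.SettingModel
open Literature.AnabelianGeometry.SemiGraphs

section TateRecord

open ModelTateCarriers

variable (p : ℕ) [Fact p.Prime] (l : ℕ+) (hlo : Odd (l : ℕ)) (hlp : (l : ℕ).Prime) (hdvd : 4 * (l : ℕ) ∣ p - 1)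
  {Es : Set ℕ+} (τ : (ThetaSetting.modelTate p).CyclotomeTower l Es)

/-- **[IUTchIII] Thm. 2.2 (ii) (d_v) AT THE GENUINE `θ_env` RECORD OF THE TATE MODEL, EVERY label** (kurims p. 65;
[IUTchII] Prop. 3.1 (i) p. 87): at abc-iut-w4-d019's `thetaEnvRecordOuterKummer` over `modelTate p` (data of record as
in p461404 / p493591; print-faithful OUTER inversion family through `e₀ := pairRhoLim …` of the pointed inversion pair,
`ι := inversionχq`; `Ψ_cns := κ(O)`, `μ ⊆ O`, `O` `Π^tp_{X̲̲}`-stable), for EVERY `ι ∈ Π^tp_{X̲̲}`: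
`(M^×_TM · H^μ / H^μ) ∩ (⟨∞θ^ι_env⟩ · H^μ / H^μ) = {1}` in `H / H^μ`, `H = lim_J H¹(Π^tp_{Ÿ̲̲} ∩ J, l·Δ_Θ)`. Proof:
`LogThetaLattice.thm22_ii_splitting_of_prop31` ∘ `prop31Statements_thetaEnvRecordOuterKummer_modelTate` (p493591) ∘
`htors_toRecord_family`. RESIDUAL: {(H1) `hcharY` = F-2633 at the instance, tower `τ`, `hOst`, Cor 3.5 (K)/(E) DATA}.
(The non-unit `q ∈ O` and `hq` sit in the signature: gate de-duplication keys on it.) SEMI-SYNTHETIC MODEL, binder-discharge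
evidence only. [claim: Mochizuki2012, status: disputed] (IUTchIII §2 Thm 2.2 (ii), kurims p.65) -/
theorem thm22_ii_splitting_thetaEnvRecordOuterKummer_modelTate
    [TopologicalSpace (PadicAlgCl p)ˣ] (O : Submonoid (PadicAlgCl p)ˣ)
    (hOtors : ∀ a : (PadicAlgCl p)ˣ, IsOfFinOrder a → a ∈ O ∧ a⁻¹ ∈ O)
    {P₀ : TopGroup.{0}} (φ₀ : P₀ →* (ThetaSetting.modelTate p).GtpTheta) [MulDistribMulAction P₀ (PadicAlgCl p)ˣ]
    (hA₀ : ∀ b : (PadicAlgCl p)ˣ, IsOpen (MulAction.stabilizer P₀ b : Set P₀))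
    (hfi₀ : ∀ b : (PadicAlgCl p)ˣ, (MulAction.stabilizer P₀ b).FiniteIndex) (q : O) (hq : ¬ IsUnit q) :
    let hC := compat_modelχq p 1 2 even_two
    let hS := ThetaSetting.modelχq_sec2Hyps p 1 2 even_two
    let K₀ := (kummerCoreχq p 1 2 even_two).toKummerDataOfSection SemidirectProduct.inr (continuous_inrχq p 1 2)
        (fun _ => rfl) (map_inr_GK_le_GtpY_modelχq' p 1 2 even_two) (map_inr_GKdd_le_GtpYdd_modelχq' p 1 2 even_two)
    let E := K₀.etaleThetaDataOfClass (etaDdχq p 1 2 even_two)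
    let C := E.doubleUnderlineχqOfEtaRes p 1 2 l hlo (eta_res_etaDdχq p 1 2 even_two l hlo)
    let h15 : ThetaSetting.Prop15iii E hC :=
      prop15iii_etaleThetaDataOfClass_etaDdχq p hC SemidirectProduct.inr (continuous_inrχq p 1 2) (fun _ => rfl)
        (map_inr_GK_le_GtpY_modelχq' p 1 2 even_two) (map_inr_GKdd_le_GtpYdd_modelχq' p 1 2 even_two)
    let L : C.CuspLabels := ⟨fun _ => ∅, fun _ => ∅, fun _ => rfl⟩
    let hO := ThetaSetting.modelχq_isEtThOrigin p 1 2 even_two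
    let hYcl := hYcl_modelχq p 1 2 even_two
    let hp2 := ne_two_of_four_mul_dvd_pred p l.pos hdvd
    let hpl := ne_of_four_mul_dvd_pred p l.pos hdvd
    let hζ := exists_isPrimitiveRoot_K_modelχq p 1 2 even_two l.pos hdvd
    let hZ : ∀ M : ℕ+, Nonempty (ModelCyclotomes.lDeltaQuot (C.rigidData (τ.modAll M) hC hS h15 L) ≃*
        Literature.IUT.HodgeTheaters.ZHat) := fun M =>
      ModelCyclotomes.nonempty_lDeltaQuot_rigidData_mulEquiv_zHat C (τ.modAll M) hC hS h15 L hO hYcl hlp.ne_zero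
    let hlim := bijective_rigidLimHom C hC hS hlp hp2 hpl hζ τ.modAll (EtaleThetaDataOfSetting.rootLift C)
      (rootLift_mem_rootCocycles C hC) τ.red_modAll h15 L hZ
    let cι : ThetaSetting.ThetaCompanion (Dα := ThetaSetting.modelTate p) (Dβ := ThetaSetting.modelTate p) (inversionχq p 1 2) :=
      (ThetaSetting.modelTate p).thetaCompanionOfAut (inversionχq p 1 2)
        (isInversionAut_inversionχq p 1 2 even_two).map_deltaTemp (hasThetaTopology_modelχq p 1 2 even_two).isQuotientMap_toTheta
    haveI := piYdd_normal C hC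
    haveI : ((ThetaSetting.modelTate p).lDeltaTheta l).Normal := ThetaSetting.lDeltaTheta_normal _ l
    haveI : IsMulCommutative ((ThetaSetting.modelTate p).lDeltaTheta l) :=
      EtaleThetaDataOfSetting.instIsMulCommutative_lDeltaTheta (D := ThetaSetting.modelTate p) l
    letI : MulDistribMulAction (Pi C) (PadicAlgCl p)ˣ := EtaleThetaDataOfSetting.unitsAction C
    ∀ (hcharY : PiYddCharacteristic C),
    let e₀ : h1Lim (phi C) ((ThetaSetting.modelTate p).lDeltaTheta l) (PiYdd C) ⊥ ≃+
        h1Lim (phi C) ((ThetaSetting.modelTate p).lDeltaTheta l) (PiYdd C) ⊥ :=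
      pairRhoLim C (inversionAlpha C (inversionχq p 1 2) (map_Huuχq_inversionχq p 1 2 l hlo)) cι.thetaIso
        (thetaCompanion_phi C (inversionχq p 1 2) (map_Huuχq_inversionχq p 1 2 l hlo) cι)
        (mem_lDeltaTheta_iff_thetaCompanion (D := ThetaSetting.modelTate p) (inversionχq p 1 2) cι l)
        (mem_PiYdd_iff_of_piYddCharacteristic C hcharY _)
    ∀ (s₀ : P₀ →* Pi C) (hs₀ : Continuous ((MonoidHom.id (Pi C)).comp s₀))
      (hN : (⊤ : Subgroup P₀).map ((MonoidHom.id (Pi C)).comp s₀) ≤ PiYdd C)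
      (hφ : (phi C).comp ((MonoidHom.id (Pi C)).comp s₀) = φ₀)
      (c : CyclotomeCoefficients (phi C) ((ThetaSetting.modelTate p).lDeltaTheta l) (PadicAlgCl p)ˣ)
      (hA : ∀ b : (PadicAlgCl p)ˣ, IsOpen (MulAction.stabilizer (Pi C) b : Set (Pi C)))
      (hfi : ∀ b : (PadicAlgCl p)ˣ, (MulAction.stabilizer (Pi C) b).FiniteIndex)
      (_hOst : ∀ (σ : Pi C) (b : (PadicAlgCl p)ˣ), b ∈ O → σ • b ∈ O)
      (c₀ : CyclotomeCoefficients φ₀ ((ThetaSetting.modelTate p).lDeltaTheta l) (PadicAlgCl p)ˣ)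
      (_hc : Function.Bijective c.hom) (_hc₀ : Function.Bijective c₀.hom) (_hc₀c : ∀ ζ, c₀.hom ζ = c.hom ζ)
      (_hact : ∀ (g : P₀) (a : (PadicAlgCl p)ˣ), g • a = s₀ g • a)
      [((EtaleThetaDataOfSetting.aug C).comp s₀).range.FiniteIndex]
      {θ : (thetaEnvRecordOuterKummer C hC hS hlp hp2 hpl hζ τ.modAll (EtaleThetaDataOfSetting.rootLift C)
        (rootLift_mem_rootCocycles C hC) τ.red_modAll h15 L hZ hcharY hlim e₀ c hA hfi O).H}
      (_hθ : θ ∈ (thetaEnvRecordOuterKummer C hC hS hlp hp2 hpl hζ τ.modAll (EtaleThetaDataOfSetting.rootLift C)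
        (rootLift_mem_rootCocycles C hC) τ.red_modAll h15 L hZ hcharY hlim e₀ c hA hfi O).thetaEnv (1 : Pi C))
      (R₀ : (thetaEnvRecordOuterKummer C hC hS hlp hp2 hpl hζ τ.modAll (EtaleThetaDataOfSetting.rootLift C)
          (rootLift_mem_rootCocycles C hC) τ.red_modAll h15 L hZ hcharY hlim e₀ c hA hfi O).H →*
        Multiplicative (h1Lim φ₀ ((ThetaSetting.modelTate p).lDeltaTheta l) (⊤ : Subgroup P₀) ⊥))
      (_hR₀ : ∀ y, Multiplicative.toAdd (R₀ y) =
        h1LimCongr ((ThetaSetting.modelTate p).lDeltaTheta l) ⊤ hφ ⊥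
          (h1LimComap (phi C) ((ThetaSetting.modelTate p).lDeltaTheta l) ((MonoidHom.id (Pi C)).comp s₀) hs₀ hN
            (AddEquiv.additiveMultiplicative (h1Lim (phi C) ((ThetaSetting.modelTate p).lDeltaTheta l) (PiYdd C) ⊥)
              (Additive.ofMul y))))
      (_hRθ : R₀ θ = h1LimKummerOn φ₀ ((ThetaSetting.modelTate p).lDeltaTheta l) ⊤ c₀ hA₀ hfi₀ O q),
      ∀ ι : Pi C,
        (((thetaEnvRecordOuterKummer C hC hS hlp hp2 hpl hζ τ.modAll (EtaleThetaDataOfSetting.rootLift C)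
            (rootLift_mem_rootCocycles C hC) τ.red_modAll h15 L hZ hcharY hlim e₀ c hA hfi O).units.map
            (QuotientGroup.mk' (CommGroup.torsion
              (thetaEnvRecordOuterKummer C hC hS hlp hp2 hpl hζ τ.modAll (EtaleThetaDataOfSetting.rootLift C)
                (rootLift_mem_rootCocycles C hC) τ.red_modAll h15 L hZ hcharY hlim e₀ c hA hfi O).H)) :
              Subgroup _) : Set _) ∩
          (QuotientGroup.mk' (CommGroup.torsion
              (thetaEnvRecordOuterKummer C hC hS hlp hp2 hpl hζ τ.modAll (EtaleThetaDataOfSetting.rootLift C)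
                (rootLift_mem_rootCocycles C hC) τ.red_modAll h15 L hZ hcharY hlim e₀ c hA hfi O).H)) ''
            (Submonoid.closure
              ((thetaEnvRecordOuterKummer C hC hS hlp hp2 hpl hζ τ.modAll (EtaleThetaDataOfSetting.rootLift C)
                (rootLift_mem_rootCocycles C hC) τ.red_modAll h15 L hZ hcharY hlim e₀ c hA hfi O).inftyThetaEnv ι) :
              Set _) = {1} := by
  intro hC hS K₀ E C h15 L hO hYcl hp2 hpl hζ hZ hlim cι hcharY e₀ s₀ hs₀ hN hφ c hA hfi hOst c₀ hc hc₀ hc₀c hact _ θ hθ R₀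
    hR₀ hRθ ι
  haveI := piYdd_normal C hC
  haveI : ((ThetaSetting.modelTate p).lDeltaTheta l).Normal := ThetaSetting.lDeltaTheta_normal _ l
  haveI : IsMulCommutative ((ThetaSetting.modelTate p).lDeltaTheta l) :=
    EtaleThetaDataOfSetting.instIsMulCommutative_lDeltaTheta (D := ThetaSetting.modelTate p) l
  letI : MulDistribMulAction (Pi C) (PadicAlgCl p)ˣ := EtaleThetaDataOfSetting.unitsAction C
  refine thm22_ii_splitting_of_prop31 _
    (Literature.IUT.HodgeArakelov.EtaleLevels.prop31Statements_thetaEnvRecordOuterKummer_modelTate p l hlo hlp hdvd τ O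
      hOtors φ₀ hA₀ hfi₀ hcharY s₀ hs₀ hN hφ c hA hfi hOst c₀ hc hc₀ hc₀c hact hθ R₀ hR₀ q hRθ hq)
    (fun u hu => ?_) ι
  exact htors_toRecord_family C hC hS hlp hp2 hpl hζ τ.modAll (EtaleThetaDataOfSetting.rootLift C)
    (rootLift_mem_rootCocycles C hC) τ.red_modAll h15 L hZ hcharY hlim _ c hA hfi O hc hOtors u
    ((CommGroup.mem_torsion _).1 hu)

end TateRecord

end Literature.IUT.LogThetaLattice

end
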